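import Literature.IUT.HodgeTheaters.PuncturedEllipticCoverings
import HarnessLib

/-!
# [IUTchI] §1 pp. 37–38 — the Δ_ε-level structure laws of a curve of type `(1, l-tors)` (interface companion)

Mochizuki, *Inter-universal Teichmüller theory I: construction of Hodge theaters*, kurims manuscript
(May 2020), §1 pp. 37–38 [cite: Mochizuki2012, IUTchI §1 pp.37-38] (D-0012 claim key, status disputed), with
[EtTh] Def. 2.1 p. 33 [cite: MochizukiEtTh2009, Def 2.1 p.33].  Cell abc-iut, layer L5, seat abc-iut-L5-t1
(§1 interface owner); abc-iut-L5-lead RULINGS #58 (10) GO «hA re-grounding», file A.  STATEMENTS ONLY: one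
`structure … : Prop` (a hypothesis binder, never asserted), no instance, no notation; ADDITIVE companion of the
frozen `PuncturedEllipticCoverings.lean` (p404449) and `PuncturedEllipticCoveringsCusps.lean` (p424023), which are
not touched.

WHY.  The printed claims of p. 38 about the §1 CONSTRUCTION (`jKer = Ker(Δ_X̲ ↠ Δ_ε⁺)`, `Π_{X̲→}`, `Π_{C̲→}`:
normality, `[Δ_X̲ : jKer] = l`, `I_ε′ ⥲ Δ_ε⁺`, indices `l`, `2l`, cyclicity, cartesianness) are typed as the
predicate `PuncturedEllipticData.ArrowCoveringClaims` and carried as the standing binder `hA` of the Layer-5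
certificate.  They are NOT derivable from the frozen fields (which carry no structure of `Δ_X̲^{ab} ⊗ ℤ/l`), but
they ARE derivable — files `PuncturedEllipticCoveringsArrowClaimsOfLaws*.lean` — from the following sentences of
print about the STANDARD objects `I_x`, `Δ_X̲^{ab} ⊗ ℤ/l`, `Δ_ε`, each a classical fact about the geometric
fundamental group of a curve of type `(1, l)` over a field of characteristic zero containing `μ_l`:

  "`Δ_X̲ ↠ Δ_X̲^{ab} ⊗ (ℤ/lℤ) ↠ Δ_ε` for the quotient of `Δ_X̲^{ab} ⊗ (ℤ/lℤ)` by the images of the inertia groups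
  of all nonzero cusps `≠ ε′, ε″` of `X̲`.  Thus, we obtain a natural exact sequence
  `0 → I_ε′ × I_ε″ → Δ_ε → Δ_E ⊗ (ℤ/lℤ) → 0` … [so we have noncanonical isomorphisms `I_ε′ ≅ ℤ/lℤ ≅ I_ε″`].
  … `ι` induces an isomorphism `I_ε′ ≅ I_ε″` … `ι` acts on `Δ_E ⊗ (ℤ/lℤ)` via multiplication by `−1`. …
  since [in light of the assumption (∗)!] the natural [outer] action of `G_k` on `Δ_ε⁺ × Gal(X̲/C̲)` is trivial"
  (p. 37 l. 30 – p. 38 l. 24).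

THE LAWS (fields of `PuncturedEllipticData.ModLCuspLaws D`), in the tree's §1 vocabulary (`D.modLKer =
Ker(Δ_X̲ ↠ Δ_X̲^{ab} ⊗ ℤ/l)`, `D.deltaEpsKer = Ker(Δ_X̲ ↠ Δ_ε)`, `D.inertia x = I_x`):
* (L0) `modLKer_relIndex_ne_zero` — "`Δ_X̲^{ab} ⊗ (ℤ/lℤ)`" is a FINITE group (`Δ_X̲` topologically finitely
  generated: SGA1 / [AbsTopI] Prop. 2.2; supplied from `GeomTFG` by `modLKer_relIndex_ne_zero_of_tfg`, p424558);
* (L1) `inertia_procyclic` — each cusp inertia group `I_x` is procyclic (`≅ Ẑ(1)`);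
* (L2a) `inertia_ε1_image_order` — "`I_ε′ ≅ ℤ/lℤ`" for the image of `I_ε′` in `Δ_ε`: `[I_ε′·Ker : Ker] = l`;
* (L2c) `inertia_images_inf_le` — "`0 → I_ε′ × I_ε″ → Δ_ε`" is exact: the two images meet trivially;
* (L3) `iota_neg` — "`ι` acts on `Δ_E ⊗ (ℤ/lℤ)` via multiplication by `−1`", `Δ_E ⊗ ℤ/l = Δ_ε/(I_ε′ × I_ε″)`,
  for `ι̲` any element of `Δ_C̲ ∖ Δ_X̲`;
* (L4) `inertia_central` — `G_k` (indeed `Π_X̲`) acts trivially on every `I_x` modulo `Ker(Δ_X̲ ↠ Δ_X̲^{ab} ⊗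
  ℤ/l)`: `μ_l ⊆ k`, which print obtains from (∗) via the Weil pairing (`det E[l] = μ_l`) — the typed field
  `star` only controls `Δ_X / Ker(Δ_X ↠ Δ_X^{ab} ⊗ ℤ/l)`, a quotient in which `Δ_X̲` has image of order `l`, and
  does not imply (L4).
NOT needed (hence not fields): the cokernel clause "`→ Δ_E ⊗ (ℤ/lℤ) → 0`" and its order `l²`; "`I_ε″ ≅
ℤ/lℤ`" (follows from (L2a) by `ι`); "`ι` induces `I_ε′ ≅ I_ε″`" (DERIVED from the cusp action `CuspGalois.act_ε1`
+ `act_decomp` + (L4): `CuspGalois.conj_inertia_ε1_mem`, p444784).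

NV: the finite §1 model `ArrowModel.datum` (p431223) satisfies these laws (its `V = N = ℤ/l × (ℤ/l)^{ℤ/l}`) —
kernel witness `ArrowModel.modLCuspLaws` (`PuncturedEllipticArrowModelModLCuspLaws.lean`, p448735, every
admissible `l`); the unoriented variant `udatum` (p437242) does too — kernel witness
`ArrowModel.modLCuspLaws_udatum` (`PuncturedEllipticArrowModelUnorientedModLCuspLaws.lean`, p455483; this
clause was unwitnessed when the file first landed: referee finding G32-F1 (ii), closed by that companion) —
(L0)–(L4) do not see the orientation of the zero cusp, in accordance with G-L5d4g6-1 (the `ε⁰` clause is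
independent and needs (gen)(rel)(inv), p438104).

HONEST FRAMING: nothing here asserts abc proved or refuted or takes a side on [IUTchIII] Cor. 3.12; the
structure is a HYPOTHESIS BINDER quoting print, never asserted; typed ≠ inhabited ≠ discharged; each field is
a sentence of p. 37–38 or a classical fact it presupposes, EXCEPT (L4), which is print's `G_k`-triviality
sentence (p. 38) carried at the `I_x`-level — the consequence print obtains from (∗) via the Weil pairing, as
the WHY paragraph above and the field docstring say (gate reviewer note (b); referee finding G32-F1 (i)); no
other printed statement is strengthened.
-/

namespace Literature.IUT.HodgeTheaters

namespace PuncturedEllipticData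

universe u

variable (D : PuncturedEllipticData.{u})

/-- INTERFACE LAWS (companion of `PuncturedEllipticData`, consumers carry it as a hypothesis): **the
`Δ_ε`-level structure of a curve of type `(1, l-tors)`** — print's sentences "`Δ_X̲ ↠ Δ_X̲^{ab} ⊗ (ℤ/lℤ) ↠ Δ_ε`
… we obtain a natural exact sequence `0 → I_ε′ × I_ε″ → Δ_ε → Δ_E ⊗ (ℤ/lℤ) → 0` … noncanonical isomorphisms
`I_ε′ ≅ ℤ/lℤ ≅ I_ε″` … `ι` acts on `Δ_E ⊗ (ℤ/lℤ)` via multiplication by `−1` … [in light of the assumption (∗)!]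
the natural [outer] action of `G_k` on `Δ_ε⁺ × Gal(X̲/C̲)` is trivial" (p. 37 l. 30 – p. 38 l. 24), together with
the two classical facts they presuppose (`Δ_X̲^{ab} ⊗ ℤ/l` finite; cusp inertia procyclic).  From these laws and
the cusp action `CuspGalois` the printed claims `ArrowCoveringClaims` about `jKer`, `Π_{X̲→}`, `Π_{C̲→}` are
THEOREMS (`PuncturedEllipticCoveringsArrowClaimsOfLaws*.lean`).  Not asserted.
([IUTchI] §1 pp.37–38) [claim: Mochizuki2012, status: disputed] -/
structure ModLCuspLaws : Prop where
  /-- (L0) "`Δ_X̲^{ab} ⊗ (ℤ/lℤ)`" (p. 37 l. 31) is finite: `[Δ_X̲ : Ker(Δ_X̲ ↠ Δ_X̲^{ab} ⊗ ℤ/l)] ≠ 0` — `Δ_X̲` is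
  topologically finitely generated (SGA1; [AbsTopI] Prop. 2.2). -/
  modLKer_relIndex_ne_zero : D.modLKer.relIndex D.DeltaXbar ≠ 0
  /-- (L1) "the inertia groups of … cusps" (p. 37 l. 32) are procyclic: `I_x ⊆ closure ⟨z_x⟩` for some
  `z_x ∈ I_x` (`I_x ≅ Ẑ(1)`). -/
  inertia_procyclic : ∀ x : D.Cusp, ∃ z ∈ D.inertia x,
    D.inertia x ≤ (Subgroup.zpowers z).topologicalClosure
  /-- (L2a) "noncanonical isomorphisms `I_ε′ ≅ ℤ/lℤ`" (p. 37 l. 36) for the image `I_ε′` of the inertia group of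
  `ε′` in `Δ_ε = Δ_X̲ / Ker(Δ_X̲ ↠ Δ_ε)`: `[I_ε′ · Ker(Δ_X̲ ↠ Δ_ε) : Ker(Δ_X̲ ↠ Δ_ε)] = l`. -/
  inertia_ε1_image_order : D.deltaEpsKer.relIndex (D.inertia D.ε1 ⊔ D.deltaEpsKer) = D.l
  /-- (L2c) "a natural exact sequence `0 → I_ε′ × I_ε″ → Δ_ε`" (p. 37 l. 34): the images of `I_ε′` and `I_ε″`
  in `Δ_ε` meet trivially. -/
  inertia_images_inf_le : D.inertia D.ε1 ⊓ (D.inertia D.ε2 ⊔ D.deltaEpsKer) ≤ D.deltaEpsKer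
  /-- (L3) "`ι` acts on `Δ_E ⊗ (ℤ/lℤ)` via multiplication by `−1`" (p. 38 l. 1), `Δ_E ⊗ (ℤ/lℤ)` being the cokernel
  of `I_ε′ × I_ε″ → Δ_ε` (p. 37 l. 34–35) and `ι ∈ Gal(X̲/C̲)` acting through any `ι̲ ∈ Δ_C̲ ∖ Δ_X̲`:
  `ι̲ v ι̲⁻¹ · v ∈ I_ε′ · I_ε″ · Ker(Δ_X̲ ↠ Δ_ε)` for `v ∈ Δ_X̲`. -/
  iota_neg : ∀ c ∈ D.DeltaCbar, c ∉ D.DeltaXbar → ∀ v ∈ D.DeltaXbar,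
    c * v * c⁻¹ * v ∈ D.inertia D.ε1 ⊔ D.inertia D.ε2 ⊔ D.deltaEpsKer
  /-- (L4) "[in light of the assumption (∗)!] the natural [outer] action of `G_k` on `Δ_ε⁺ …` is trivial"
  (p. 38 l. 22–24): `Π_X̲` acts trivially on every cusp inertia group modulo `Ker(Δ_X̲ ↠ Δ_X̲^{ab} ⊗ ℤ/l)` —
  `μ_l ⊆ k` (from (∗) by the Weil pairing). -/
  inertia_central : ∀ x : D.Cusp, ∀ g ∈ D.PiXbar, ∀ z ∈ D.inertia x, g * z * g⁻¹ * z⁻¹ ∈ D.modLKer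

end PuncturedEllipticData

end Literature.IUT.HodgeTheaters
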